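import Summits.AnomalousDissipation.AnomalousDissipation.Theorems.ResolvedDissipation.Negative.ShearMode
import Summits.AnomalousDissipation.AnomalousDissipation.Theorems.MomentParityQuarticGateAtomicMeasure

/-!
# Negative knowledge for the crux `MomentParity.UniformResolution` (stmt-AnomalousDissipation-14330), II:
# the shear family at frequency `K` and its symmetric two-atom law

Certified copy of section C of the cdisprove work file `Cruxes/UniformResolution/Disproof.lean`
(refuter-cdisprove-stmt-AnomalousDissipation-14330-0, cycle 1). Supports stmt-AnomalousDissipation-14330; no
route-item statement is asserted. The shear family `shearField M a = a cos(2πMx₁)e₀` / `shearState` is REUSED from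
the sibling crux's `Theorems/ResolvedDissipation/Negative/ShearMode.lean` (resubmission of p83646 per the review).

* `shearField_neg`; `nsGeneratorPairing_zero_force_shear`: at ZERO force `⟨F₀(S), w⟩ = −4π²K²ν ∫⟪S, w⟫` for smooth `w`.
* `shearLaw K hK a = ½(δ_{[S_{K,a}]} + δ_{[S_{K,−a}]})`: probability, level `N ≥ K`, support `|a|`, energy
  `a²/2`, dissipation `2π²K²νa²`, and 2-STATIONARY AT ZERO FORCE at every level and viscosity
  (`isPolyStationary_two_shearLaw`: linear observables have `u`-independent test fields, the two rows cancel).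
  Used in `Negative/LoadBearing.lean`: the mean-row-only antecedent of the crux is loud at `f = 0`.
-/

namespace Summit.AnomalousDissipation.AnomalousDissipation.Theorems.UniformResolution.Negative

open MeasureTheory Filter Topology
open scoped ENNReal InnerProductSpace RealInnerProductSpace
open Literature.Analysis.FunctionSpaces Literature.Analysis.FluidPDE
open Summit.AnomalousDissipation.AnomalousDissipation.Theses.MomentParity
open Summit.AnomalousDissipation.AnomalousDissipation.Theorems.QuarticGate.Negative
open Summit.AnomalousDissipation.AnomalousDissipation.Theorems
open Summit.AnomalousDissipation.AnomalousDissipation.Theorems.ResolvedDissipation.Negative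

noncomputable section

/-- Local notation for the real Hilbert space `L²(T³; ℝ³)`. -/
local notation "L2T3" => Lp (EuclideanSpace ℝ (Fin 3)) 2 (volume : Measure (UnitAddTorus (Fin 3)))

/-! ## C. Loud TWO-atom shear laws that are 2-stationary at ZERO force (shear family from `ShearMode`) —
the antecedent's stationarity is load-bearing at degree ≥ 2 observables -/

section Shear

/-- `S_{K,-a} = -S_{K,a}`. [folklore] -/
theorem shearField_neg (K : ℕ) (a : ℝ) (x : UnitAddTorus (Fin 3)) :
    shearField K (-a) x = -shearField K a x := by
  rw [show -a = (-1) * a by ring, shearField_mul, neg_one_smul]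

/-- **The generator row of a shear state at ZERO force**: for every smooth test field `w`,
`⟨F₀(S_{K,a}), w⟩ = ν (S, Δw) + ∫⟪(S·∇)w, S⟫ = −4π²K²ν ∫⟪S_{K,a}, w⟫`
(transport term `0`, Stokes term by `ΔS = −4π²K²S`; `ShearMode`'s integral identities). [folklore] -/
theorem nsGeneratorPairing_zero_force_shear {ν a : ℝ} {K : ℕ} {U : Torus.energySpace (Fin 3)}
    (hU : ((U.1 : L2T3) : UnitAddTorus (Fin 3) → EuclideanSpace ℝ (Fin 3)) =ᵐ[volume] shearField K a)
    {w : UnitAddTorus (Fin 3) → EuclideanSpace ℝ (Fin 3)} (hw : Torus.IsSmooth w) :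
    Torus.nsGeneratorPairing ν (fun _ => 0) U w =
      -(4 * Real.pi ^ 2 * (K : ℝ) ^ 2 * ν) * ∫ x, ⟪shearField K a x, w x⟫_ℝ := by
  have hS := isSmooth_shearField K a
  rw [Torus.nsGeneratorPairing_eq_flux ν (memLp_const 0) hw hU]
  have hi1 : Integrable (fun x => ⟪shearField K a x, Torus.convect (shearField K a) w x⟫_ℝ) volume :=
    (hS.continuous.inner (hS.convect hw).continuous).integrable_unitAddTorus
  have hi2 : Integrable (fun x => ν * ⟪shearField K a x, Torus.laplacian w x⟫_ℝ) volume :=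
    ((hS.continuous.inner hw.laplacian.continuous).integrable_unitAddTorus).const_mul ν
  have hi3 : Integrable (fun x => ⟪(fun _ => (0 : EuclideanSpace ℝ (Fin 3))) x, w x⟫_ℝ) volume := by
    simp
  have hi12 : Integrable (fun x => ⟪shearField K a x, Torus.convect (shearField K a) w x⟫_ℝ +
      ν * ⟪shearField K a x, Torus.laplacian w x⟫_ℝ) volume := hi1.add hi2
  rw [integral_add hi12 hi3, integral_add hi1 hi2, integral_const_mul, integral_inner_convect_shearField K a hw,
    integral_inner_laplacian_shearField K a hw]
  simp only [inner_zero_left, integral_zero, add_zero, zero_add]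
  ring

/-- The symmetric two-atom family `b ↦ [S_{K,±a}]`. -/
def shearPair (K : ℕ) (hK : K ≠ 0) (a : ℝ) : Bool → Torus.energySpace (Fin 3)
  | true => shearState K hK a
  | false => shearState K hK (-a)

/-- The SYMMETRIC TWO-ATOM SHEAR LAW `μ_{K,a} = ½(δ_{[S_{K,a}]} + δ_{[S_{K,−a}]})`. -/
def shearLaw (K : ℕ) (hK : K ≠ 0) (a : ℝ) : Measure (Torus.energySpace (Fin 3)) :=
  ((Fintype.card Bool : ℝ≥0∞))⁻¹ • ∑ b, Measure.dirac (shearPair K hK a b)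

/-- `‖atom‖² = a²/2` for both atoms. [folklore] -/
theorem norm_sq_shearPair {K : ℕ} (hK : K ≠ 0) (a : ℝ) (b : Bool) : ‖shearPair K hK a b‖ ^ 2 = a ^ 2 / 2 := by
  cases b
  · rw [shearPair, norm_sq_shearState]; ring
  · rw [shearPair, norm_sq_shearState]

/-- `‖∇ atom‖² = 2π²K²a²` for both atoms. [folklore] -/
theorem eGradNormSq_shearPair {K : ℕ} (hK : K ≠ 0) (a : ℝ) (b : Bool) :
    Torus.eGradNormSq (((shearPair K hK a b).1 : L2T3) : UnitAddTorus (Fin 3) → EuclideanSpace ℝ (Fin 3)) =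
      ENNReal.ofReal (2 * Real.pi ^ 2 * (K : ℝ) ^ 2 * a ^ 2) := by
  cases b
  · rw [shearPair, eGradNormSq_congr_ae (coe_shearState_ae hK _), eGradNormSq_shearField hK]
    congr 1; ring
  · rw [shearPair, eGradNormSq_congr_ae (coe_shearState_ae hK _), eGradNormSq_shearField hK]

/-- A polynomial of total degree `≤ 1` has constant partial derivatives (copy of
`MomentParityQuarticGate.pderiv_eq_C_of_totalDegree_le_one`, to keep imports light). [folklore] -/
theorem pderiv_eq_C_of_totalDegree_le_one' {m : ℕ} (P : MvPolynomial (Fin m) ℝ)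
    (hP : P.totalDegree ≤ 1) (i : Fin m) :
    MvPolynomial.pderiv i P = MvPolynomial.C (P.coeff (Finsupp.single i 1)) := by
  classical
  refine MvPolynomial.ext _ _ fun d => ?_
  rw [MvPolynomial.coeff_pderiv, MvPolynomial.coeff_C]
  by_cases hd : d = 0
  · subst hd
    simp
  · rw [if_neg (Ne.symm hd), MvPolynomial.coeff_eq_zero_of_totalDegree_lt, zero_mul]
    have hdeg : (d + Finsupp.single i 1).degree = d.degree + 1 := by
      rw [map_add, Finsupp.degree_single]
    have hd1 : 1 ≤ d.degree :=
      Nat.one_le_iff_ne_zero.mpr fun h => hd ((Finsupp.degree_eq_zero_iff d).mp h)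
    have key : P.totalDegree < (d + Finsupp.single i 1).degree := by
      rw [hdeg]
      omega
    rwa [Finsupp.degree_apply] at key

/-- For `P` of total degree `≤ 1` the test field `∇p(u) = Σᵢ ∂ᵢP gᵢ` does not depend on `u`. [folklore] -/
theorem polyGrad_eq_of_totalDegree_le_one {m : ℕ} (g : Fin m → UnitAddTorus (Fin 3) → EuclideanSpace ℝ (Fin 3))
    {P : MvPolynomial (Fin m) ℝ} (hP : P.totalDegree ≤ 1) (u : Torus.energySpace (Fin 3)) :
    polyGrad g P u = fun x => ∑ i, P.coeff (Finsupp.single i 1) • g i x := by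
  funext x
  simp only [polyGrad]
  refine Finset.sum_congr rfl fun i _ => ?_
  rw [pderiv_eq_C_of_totalDegree_le_one' P hP i, MvPolynomial.eval_C]

/-- **The symmetric shear law is 2-STATIONARY at ZERO force** (every viscosity, every level): for a
linear observable the test field `w = Σ cᵢgᵢ` is `u`-independent and the two rows
`∓4π²K²ν ∫⟪S_{K,a}, w⟫` cancel. [folklore] -/
theorem isPolyStationary_two_shearLaw (ν : ℝ) {K : ℕ} (hK : K ≠ 0) (a : ℝ) (N : ℕ) :
    IsPolyStationary ν (fun _ => 0) N 2 (shearLaw K hK a) := by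
  intro m g P hg hP
  refine ⟨MomentParityQuarticGate.integrable_average _ _, ?_⟩
  rw [shearLaw, MomentParityQuarticGate.integral_average]
  have hP1 : P.totalDegree ≤ 1 := by omega
  have hw : Torus.IsSmooth (fun x => ∑ i, P.coeff (Finsupp.single i 1) • g i x) :=
    Torus.isSmooth_sum_smul Finset.univ _ fun i _ => (hg i).1
  simp_rw [polyGrad_eq_of_totalDegree_le_one g hP1]
  rw [Fintype.sum_bool]
  have ht : shearPair K hK a true = shearState K hK a := rfl
  have hf : shearPair K hK a false = shearState K hK (-a) := rfl
  rw [ht, hf, nsGeneratorPairing_zero_force_shear (coe_shearState_ae hK a) hw,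
    nsGeneratorPairing_zero_force_shear (coe_shearState_ae hK (-a)) hw]
  simp_rw [shearField_neg, inner_neg_left, integral_neg]
  ring

/-- The symmetric shear law is a probability measure. [folklore] -/
instance isProbabilityMeasure_shearLaw {K : ℕ} (hK : K ≠ 0) (a : ℝ) :
    IsProbabilityMeasure (shearLaw K hK a) :=
  MomentParityQuarticGate.isProbabilityMeasure_average _

/-- The symmetric shear law is carried by level-`N` fields, `K ≤ N`. [folklore] -/
theorem ae_isLevel_shearLaw {K : ℕ} (hK : K ≠ 0) (a : ℝ) {N : ℕ} (hKN : K ≤ N) :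
    ∀ᵐ u ∂(shearLaw K hK a), IsLevel N u :=
  MomentParityQuarticGate.ae_average _ fun b => by
    cases b
    · exact isLevel_shearState hK _ hKN
    · exact isLevel_shearState hK _ hKN

/-- The symmetric shear law is supported in `‖u‖ ≤ |a|`. [folklore] -/
theorem ae_norm_le_shearLaw {K : ℕ} (hK : K ≠ 0) (a : ℝ) :
    ∀ᵐ u ∂(shearLaw K hK a), ‖u‖ ≤ |a| := by
  refine MomentParityQuarticGate.ae_average _ fun b => ?_
  have h := norm_sq_shearPair hK a b
  refine (sq_le_sq₀ (norm_nonneg _) (abs_nonneg a)).1 ?_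
  rw [sq_abs, h]
  linarith [sq_nonneg a]

/-- Mean energy of the symmetric shear law: `a²/2`. [folklore] -/
theorem ensembleEnergy_shearLaw {K : ℕ} (hK : K ≠ 0) (a : ℝ) :
    Torus.ensembleEnergy (shearLaw K hK a) = a ^ 2 / 2 := by
  rw [shearLaw, MomentParityQuarticGate.ensembleEnergy_average, Fintype.sum_bool, norm_sq_shearPair,
    norm_sq_shearPair, Fintype.card_bool]
  push_cast
  ring

/-- Mean dissipation of the symmetric shear law: `2π²K²νa²`. [folklore] -/
theorem ensembleDissipation_shearLaw (ν : ℝ) {K : ℕ} (hK : K ≠ 0) (a : ℝ) :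
    Torus.ensembleDissipation ν (shearLaw K hK a) = ν * (2 * Real.pi ^ 2 * (K : ℝ) ^ 2 * a ^ 2) := by
  rw [shearLaw, MomentParityQuarticGate.ensembleDissipation_average _ ν
    (e := fun _ => 2 * Real.pi ^ 2 * (K : ℝ) ^ 2 * a ^ 2) (fun _ => by positivity)
    (eGradNormSq_shearPair hK a), Fintype.sum_bool, Fintype.card_bool]
  push_cast
  ring

end Shear

end

end Summit.AnomalousDissipation.AnomalousDissipation.Theorems.UniformResolution.Negative
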